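import Summits.QuantumFields.YangMills.Theorems.UnitScaleTiltProp7SectET3DeltaOneT3JTermRows
import Summits.QuantumFields.YangMills.Theorems.UnitScaleTiltProp7QTwSCentralTowerRows
import HarnessLib

/-!
# Route `UnitScaleTilt`, crux «MinimiserStabilityRegPr» (stmt-QuantumFields-19200, stub EX) ∕ (O″χ) B0 (stmt-QuantumFields-20520), node N06(d = 3), route (α) —
# LAYER 0, ROWS OF BRICK L0b PART 4, CLOSING COROLLARY (def-free): **THE J-TERM OF RECORD `T_J(U₀)` IS REAL AND THE EX KNIT'S `hH₁R` CLAUSE HOLDS AT PRINT'S `Δ₁` WITH THE J-TERM —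
# UNCONDITIONALLY AT `U₀ ∈ 𝔘_k(ε₀)`** in the windows `10⁹L²e ≤ 1`, `10¹²L³ε₀ ≤ 1`: the single displayed row `hAvgC` of ✓`…DeltaOneT3JTermRows` (centre-flatness of the averaging's quadratic term
# `C⁽²⁾(U₀)`) is DISCHARGED BY NAME from ★w5-20520 g5's ✓`Prop7SymAvgTwSym.fderiv_fderiv_logChartTwS_central_eq_zero_at_regPr` ((Q-b)⁽²⁾: centre-additivity of the twisted log-chart + the tower rows at `RegPr`)

Cell `ym-inputs` (desk `pub/ym-inputs`, INPUT-LIST.md v11 §4 row p01 «re-point SIG 4's `hAvgC` to FILE 6's theorem BY NAME»).  THEOREMS ONLY (0 `def`, 0 `sorry`); `--supports stmt-QuantumFields-20520 --as helper`;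
count-neutral.  YM₃ on T³ is ladder rung R3, NOT the Clay problem; nothing here is a claim about a stub, a crux, d = 4 or the mass gap.

WHAT IS PROVED: ★★★`TJ_rows_at_regPr (hε₀ he hWe hWε) (U₀) (hreg)` — the σ-row, the traceless row and the symmetry of `TJ F n K h c₀ cB a U₀` with NO displayed row; ★★★`H1f_isHermitian_traceless_at_regPr_DeltaOneJ'
(hε₀ he hWe hWε) (U₀) (hreg)` — Hermitian traceless block data give Hermitian traceless `(H₁f … (DeltaOne … TJSlot) U₀ B)(x)`, i.e. the knit's `hH₁R` at `Δ₁` OF RECORD, with NO displayed row; `DeltaOneJ_reality_rows_at_regPr` —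
the three `Δ₁`-of-record slot rows (`hΔx`, `hΔtr`, `hΔsymm` shapes of ★w4's ✓`H1f_isHermitian_traceless_at_regPr`) for other consumers (★w4-20520 g5's `h𝒢R` twin).
HONEST SCOPE.  Three-line compositions of landed theorems; no estimate; nothing of print asserted; N06 NOT discharged (positivity ∕ sizes of `Δ₁`'s propagators stay Track A's); no stub closed.

References: T. Bałaban, CMP **99** (1985) 389–434 [Balaban1985BackgroundPropagators] ((3.127)–(3.129) p.421, (3.14) p.393); CMP **102** (1985) 277–309 [Balaban1985Variational] ((51) p.286, (103) p.293, (110) p.294).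
-/

set_option autoImplicit false

noncomputable section

open scoped InnerProductSpace ComplexConjugate Matrix.Norms.L2Operator BigOperators

namespace Summit.QuantumFields.YangMills.Theorems.Prop7SectET3DeltaOne

open Literature.MathematicalPhysics.QuantumFieldTheory.Balaban1983to89
open Literature.MathematicalPhysics.QuantumFieldTheory.Balaban1983to89.T3ContinuumYM3Torus
open T3SectALandauChart (eta eta_pos)
open T3PrintedRegularMinimiser (RegPr)
open B9SectCLatticeCarrier (Bond)
open B9Eq311L2Pairing (WL2)
open B11Eq103H1Complex (SiteL2K BondL2K)
open B11Eq115Space (JetSup)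
open Summit.QuantumFields.YangMills.Theorems.Prop7SectET3Transport (periodsT3 bondEquiv bgOfCfg)
open Summit.QuantumFields.YangMills.Theorems.Prop7SectET3HilbertLetters (W₂ toL2 toL2B)
open Summit.QuantumFields.YangMills.Theorems.Prop7SectET3CurvedPropagators (H1f)
open Summit.QuantumFields.YangMills.Theorems.Prop7SymAvgTwSym (fderiv_fderiv_logChartTwS_central_eq_zero_at_regPr)

variable (F : T3Family) {n K : ℕ} (h : n ≤ K) (c₀ cB a : ℝ) [Fact (0 < c₀)] [Fact (0 < cB)]

/-- **`hAvgC` AT `U₀ ∈ 𝔘_k(ε₀)` BY NAME** — the centre-flatness of `C⁽²⁾(U₀)` in the `avgHess` spelling (★w5-20520 g5's ✓`fderiv_fderiv_logChartTwS_central_eq_zero_at_regPr`, `avgHess_def`).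
[cite: Balaban1985BackgroundPropagators, (3.14) p.393; Balaban1985Variational, (51) p.286] -/
theorem avgHess_apply_smul_one_eq_zero_of_regPr {ε₀ : ℝ} (hε₀ : 0 < ε₀) (hWε : 10 ^ 12 * (F.L : ℝ) ^ 3 * ε₀ ≤ 1)
    (U₀ : GaugeField (F.P K) 0 (Matrix.specialUnitaryGroup (Fin 2) ℂ)) (hreg : RegPr F n K ε₀ U₀) :
    ∀ (X : PBond (F.P K) 0 → Matrix (Fin 2) (Fin 2) ℂ) (z : PBond (F.P K) 0 → ℂ), avgHess F n K h U₀ X (fun b => z b • (1 : Matrix (Fin 2) (Fin 2) ℂ)) = 0 := fun X z => by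
  rw [avgHess_def]
  exact fderiv_fderiv_logChartTwS_central_eq_zero_at_regPr F h hε₀ hWε U₀ hreg X z

/-- ★★★ **THE THREE ROWS OF THE J-TERM OF RECORD, UNCONDITIONAL AT `U₀ ∈ 𝔘_k(ε₀)`** (σ-row ∧ traceless row ∧ symmetry of `T_J(U₀)`; windows `10⁹L²e ≤ 1`, `10¹²L³ε₀ ≤ 1`).
[cite: Balaban1985BackgroundPropagators, (3.127)–(3.128) p.421; Balaban1985Variational, (51) p.286] -/
theorem TJ_rows_at_regPr [Fact (0 < (F.L : ℝ))] [Fact (0 < ((F.L : ℝ)⁻¹) ^ (K - n))]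
    {ε₀ e : ℝ} (hε₀ : 0 < ε₀) (he : 0 < e) (hWe : 10 ^ 9 * (F.L : ℝ) ^ 2 * e ≤ 1) (hWε : 10 ^ 12 * (F.L : ℝ) ^ 3 * ε₀ ≤ 1)
    (U₀ : GaugeField (F.P K) 0 (Matrix.specialUnitaryGroup (Fin 2) ℂ)) (hreg : RegPr F n K ε₀ U₀) :
    (∀ f : BondL2K ℂ 3 (periodsT3 F K) c₀ W₂,
        TJ F n K h c₀ cB a U₀ (toL2 F K c₀ (star ((toL2 F K c₀).symm f))) = toL2 F K c₀ (star ((toL2 F K c₀).symm (TJ F n K h c₀ cB a U₀ f)))) ∧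
      (∀ A : PBond (F.P K) 0 → Matrix (Fin 2) (Fin 2) ℂ, (∀ b, (A b).trace = 0) → ∀ b, ((toL2 F K c₀).symm (TJ F n K h c₀ cB a U₀ (toL2 F K c₀ A)) b).trace = 0) ∧
      ((TJ F n K h c₀ cB a U₀ : BondL2K ℂ 3 (periodsT3 F K) c₀ W₂ →L[ℂ] BondL2K ℂ 3 (periodsT3 F K) c₀ W₂) :
        BondL2K ℂ 3 (periodsT3 F K) c₀ W₂ →ₗ[ℂ] BondL2K ℂ 3 (periodsT3 F K) c₀ W₂).IsSymmetric :=
  TJ_rows_of_regPr F h c₀ cB a hε₀ he hWe hWε U₀ hreg (avgHess_apply_smul_one_eq_zero_of_regPr F h hε₀ hWε U₀ hreg)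

/-- ★★★ **THE `Δ₁`-OF-RECORD SLOT ROWS, UNCONDITIONAL AT `U₀ ∈ 𝔘_k(ε₀)`** — the `hΔx` ∕ `hΔtr` ∕ `hΔsymm` binder shapes of ★w4's ✓`H1f_isHermitian_traceless_at_regPr` at `Δx := DeltaOne … (TJSlot …)`, for any
consumer of the `Δ₁` letters (`h𝒢R`, `hH₁R`, …). [cite: Balaban1985BackgroundPropagators, (3.128) p.421; Balaban1985Variational, (51) p.286] -/
theorem DeltaOneJ_reality_rows_at_regPr [Fact (0 < (F.L : ℝ))] [Fact (0 < ((F.L : ℝ)⁻¹) ^ (K - n))]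
    {ε₀ e : ℝ} (hε₀ : 0 < ε₀) (he : 0 < e) (hWe : 10 ^ 9 * (F.L : ℝ) ^ 2 * e ≤ 1) (hWε : 10 ^ 12 * (F.L : ℝ) ^ 3 * ε₀ ≤ 1)
    (U₀ : GaugeField (F.P K) 0 (Matrix.specialUnitaryGroup (Fin 2) ℂ)) (hreg : RegPr F n K ε₀ U₀) :
    (∀ f : BondL2K ℂ 3 (periodsT3 F K) c₀ W₂,
        DeltaOne F n K h c₀ cB a (TJSlot F n K h c₀ cB a) U₀ (toL2 F K c₀ (star ((toL2 F K c₀).symm f))) =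
          toL2 F K c₀ (star ((toL2 F K c₀).symm (DeltaOne F n K h c₀ cB a (TJSlot F n K h c₀ cB a) U₀ f)))) ∧
      (∀ A : PBond (F.P K) 0 → Matrix (Fin 2) (Fin 2) ℂ, (∀ b, (A b).trace = 0) →
        ∀ b, ((toL2 F K c₀).symm (DeltaOne F n K h c₀ cB a (TJSlot F n K h c₀ cB a) U₀ (toL2 F K c₀ A)) b).trace = 0) ∧
      (DeltaOne F n K h c₀ cB a (TJSlot F n K h c₀ cB a) U₀).IsSymmetric := by
  obtain ⟨hT, hTtr, hTsymm⟩ := TJ_rows_at_regPr F h c₀ cB a hε₀ he hWe hWε U₀ hreg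
  exact ⟨DeltaOne_toL2_star_of_regPr F n K h c₀ cB a (TJSlot F n K h c₀ cB a) U₀ hε₀ he hWe hWε hreg hT,
    trace_DeltaOne_toL2_eq_zero_of_regPr F n K h c₀ cB a (TJSlot F n K h c₀ cB a) U₀ hε₀ he hWe hWε hreg hTtr hTsymm, DeltaOne_isSymmetric (TJ := TJSlot F n K h c₀ cB a) hTsymm⟩

/-- ★★★ **THE KNIT'S `hH₁R` CLAUSE AT PRINT'S `Δ₁` WITH THE J-TERM OF RECORD — UNCONDITIONAL AT `U₀ ∈ 𝔘_k(ε₀)`** in the windows `10⁹L²e ≤ 1`, `10¹²L³ε₀ ≤ 1`: Hermitian traceless block data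
`B` give Hermitian traceless `(H₁f … (DeltaOne … TJSlot) U₀ B)(x)`. [cite: Balaban1985Variational, (103) p.293, (110) p.294, (51) p.286; Balaban1985BackgroundPropagators, (3.127)–(3.129) p.421] -/
theorem H1f_isHermitian_traceless_at_regPr_DeltaOneJ' [Fact (0 < (F.L : ℝ))] [Fact (0 < ((F.L : ℝ)⁻¹) ^ (K - n))]
    {ε₀ e : ℝ} (hε₀ : 0 < ε₀) (he : 0 < e) (hWe : 10 ^ 9 * (F.L : ℝ) ^ 2 * e ≤ 1) (hWε : 10 ^ 12 * (F.L : ℝ) ^ 3 * ε₀ ≤ 1)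
    (U₀ : GaugeField (F.P K) 0 (Matrix.specialUnitaryGroup (Fin 2) ℂ)) (hreg : RegPr F n K ε₀ U₀) :
    ∀ B : PBond (F.P n) 0 → Matrix (Fin 2) (Fin 2) ℂ, (∀ c, (B c).IsHermitian ∧ (B c).trace = 0) →
      ∀ x : Bond 3 (periodsT3 F K), (JetSup.equiv _ _ _ (H1f F n K h c₀ cB a (DeltaOne F n K h c₀ cB a (TJSlot F n K h c₀ cB a)) U₀ B) x).IsHermitian ∧
        (JetSup.equiv _ _ _ (H1f F n K h c₀ cB a (DeltaOne F n K h c₀ cB a (TJSlot F n K h c₀ cB a)) U₀ B) x).trace = 0 :=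
  H1f_isHermitian_traceless_at_regPr_DeltaOneJ F h c₀ cB a hε₀ he hWe hWε U₀ hreg (avgHess_apply_smul_one_eq_zero_of_regPr F h hε₀ hWε U₀ hreg)

end Summit.QuantumFields.YangMills.Theorems.Prop7SectET3DeltaOne

end
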